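import Literature.AlgebraicGeometry.Motives.HodgeLieRigid
import Literature.AlgebraicGeometry.Motives.HodgeLieReductiveAnyWeight
import Literature.AlgebraicGeometry.Motives.HodgeLieWeightOneIdealPair
import Literature.AlgebraicGeometry.Motives.HodgeThetaSubalgebraUnitary
import Literature.AlgebraicGeometry.Motives.HodgeLieRankThreeSpanC
import HarnessLib

/-!
# Weight one, plus-line position: the Hodge Lie algebra is `ℚ`-SIMPLE

Family `hodge`, layer `Literature/AlgebraicGeometry/Motives`; THEOREMS ONLY (no definition, no named fact; D-0026).
Written for the cell `pub-hodge-ring2` (literature lane, gen 67, programme R44 «shape (S1) = `Hg = Sp₁₀` for simple abelian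
fivefolds with `End⁰ = ℚ`», file F2).  Honest framing of that cell: research route conditional on HC_CM; not a corollary;
Q11.4-sentence-2 already refuted in dim ≥ 3.  (This file itself is unconditional linear algebra of polarizable Hodge structures.)

SETTING.  `H` a polarized `ℚ`-Hodge structure of weight `1`, effective, on a finite-dimensional `V`; `𝔥 = Lie Hg(H)`
(`hodgeLie`), `𝔥_ℂ = hodgeLieC = spanC 𝔥`; `Θ` the Hodge operator (`+1` on `V^{1,0}`, `−1` on `V^{0,1}`).  The PLUS-LINE
(type-III-like, Mumford-type) POSITION is the datum produced by `SymplecticThetaTen.dichotomy` /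
`SymplecticThetaTen.plusLine_of_forall_scalar` (file `HodgeThetaSubalgebraSymplecticRankTen`): a non-zero raising operator
`B₀ ∈ 𝔥_ℂ` (`B₀(V^{1,0}) = 0`, `B₀ V_ℂ ⊆ V^{1,0}`) spanning ALL raising operators of `𝔥_ℂ`, its conjugate `C₀ = B̄₀`, and
`μ₀ ≠ 0` with `B₀C₀ = μ₀` on `V^{1,0}`, `C₀B₀ = μ₀` on `V^{0,1}` — so that `𝔰 = ⟨B₀, C₀, Θ⟩ ≅ 𝔰𝔩₂(ℂ)` and `[B₀, C₀] = μ₀Θ`.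

RESULTS.
* §1 **`hodgeLie_inf_endAlg_eq_bot_of_forall_endAlg_eq_smul`** — if `End_Hdg(V) = ℚ` then `𝔷 = 𝔥 ∩ End_Hdg = 0`
  (a `ψ`-skew rational scalar vanishes).
* §2 **`hodgeLie_le_of_plusPair_mem_spanC`** — a bracket-closed rational `𝔞 ⊆ 𝔥` whose complex span contains `B₀` is all
  of `𝔥`: `𝔞_ℂ ∋ C₀ = B̄₀` (real structure), `∋ [B₀, C₀] = μ₀Θ`, and `Lie Hg` is `Θ`-rigid (`hodgeLie_rigid`, Moonen–Zarhin (3.1):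
  `Hg` is the smallest `ℚ`-group containing `h(U¹)`).
* §3 **`isSimple_hodgeLie_of_plusLine`** — in the plus-line position with `𝔷 = 0`, EVERY Lie subalgebra `𝔏 ≤ 𝔤𝔩_ℚ(V)` with
  carrier `Lie Hg(H)` is a SIMPLE Lie algebra over `ℚ` (`LieAlgebra.IsSimple ℚ 𝔏`) — the hypothesis `hsimple` of the tree's
  `HodgeLieWeightOnePlusLineKilling` / `…Sl2Triple` / `…Casimir` / `…Commutant` / `…Parity`.  PROOF (Deligne I 3.4–3.6,
  Moonen–Zarhin (2.3), (3.1)): `𝔷 = 0` makes `𝔥 = [𝔥, 𝔥]` semisimple (`AnyWeight.isSemisimple_of_eq_hodgeLie_derived`); an ideal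
  `I` has a complementary ideal `J`, `𝔥_ℂ = I_ℂ + J_ℂ`; the `ad Θ`-weight-`2` components of the `I_ℂ`- and `J_ℂ`-parts of
  `B₀` stay in `I_ℂ`, `J_ℂ` (ideals are `ad Θ`-stable) and are raising, hence multiples `aB₀`, `bB₀` of `B₀` with `a + b = 1`;
  so `B₀ ∈ I_ℂ` (then `I = 𝔥` by §2) or `B₀ ∈ J_ℂ` (then `J = 𝔥`, `I = I ∩ J = 0`).  Non-abelian: `B₀ ≠ 0`.
* §4 **`isSimple_hodgeLie_of_plusLine_of_forall_endAlg_eq_smul`** — the same with `𝔷 = 0` replaced by `End_Hdg(V) = ℚ`.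

## References

* [Deligne1982HodgeCycles] P. Deligne, *Hodge cycles on abelian varieties*, LNM 900 (1982), I §3, Prop. 3.4, Prop. 3.6,
  Example 3.7.
* [MoonenZarhin1999LowDim] B. Moonen, Yu. Zarhin, *Hodge classes on abelian varieties of low dimension*, Math. Ann. 315
  (1999), §2 (2.3) (type III / Mumford position), §3 (3.1) (`Hg` is the smallest `ℚ`-subgroup containing `h(U¹)`).
* [Humphreys1972] J. E. Humphreys, GTM 9 (1972), §5.2 (ideals of a semisimple Lie algebra and their complements).
-/

noncomputable section

open scoped TensorProduct

namespace Literature.AlgebraicGeometry.Motives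

universe u

namespace HodgeStructure

/-! ## §0 Raising components for an `ad Θ`-stable subspace -/

section Raise

variable {M : Type*} [AddCommGroup M] [Module ℂ M]

/-- For an involution `T` and a subspace `𝔊 ⊆ End(M)` stable under `ad T` (not necessarily containing `T`, e.g. the complex
span of an ideal of a Lie algebra containing `T`), the raising component `P Z Q = ¼(Z + TZ − ZT − TZT) = ([T,[T,Z]] + 2[T,Z])/8`
of `Z ∈ 𝔊` lies in `𝔊` (root-space decomposition under `ad T`; variant of `UnitaryTheta.raise_mem`).
[cite: Deligne1982HodgeCycles, I §3 (proof of Prop. 3.4: `ad μ` has weights `0, ±1`)] -/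
theorem PlusLineSimple.raise_mem_of_ad_stable {𝔊 : Submodule ℂ (Module.End ℂ M)} {T : Module.End ℂ M}
    (had : ∀ Z ∈ 𝔊, T * Z - Z * T ∈ 𝔊) (hTT : ∀ v, T (T v) = v) {Z : Module.End ℂ M} (hZ : Z ∈ 𝔊) :
    (4 : ℂ)⁻¹ • (Z + T * Z - Z * T - T * Z * T) ∈ 𝔊 := by
  have hT2 : T * T = 1 := LinearMap.ext fun v => by rw [Module.End.mul_apply, hTT, Module.End.one_apply]
  have h1 : T * Z - Z * T ∈ 𝔊 := had Z hZ
  have h2 : T * (T * Z - Z * T) - (T * Z - Z * T) * T ∈ 𝔊 := had _ h1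
  have h2' : T * (T * Z - Z * T) - (T * Z - Z * T) * T = (2 : ℂ) • Z - (2 : ℂ) • (T * Z * T) := by
    rw [mul_sub, sub_mul, ← mul_assoc, hT2, one_mul, mul_assoc Z T T, hT2, mul_one, ← mul_assoc]
    module
  have h : (4 : ℂ)⁻¹ • (Z + T * Z - Z * T - T * Z * T) =
      (8 : ℂ)⁻¹ • (T * (T * Z - Z * T) - (T * Z - Z * T) * T) + (4 : ℂ)⁻¹ • (T * Z - Z * T) := by
    rw [h2']
    module
  rw [h]
  exact Submodule.add_mem _ (Submodule.smul_mem _ _ h2) (Submodule.smul_mem _ _ h1)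

/-- The raising component is additive in `Z`. [cite: Deligne1982HodgeCycles, I §3 (proof of Prop. 3.4)] -/
theorem PlusLineSimple.raise_add (T Z Z' : Module.End ℂ M) :
    (4 : ℂ)⁻¹ • ((Z + Z') + T * (Z + Z') - (Z + Z') * T - T * (Z + Z') * T) =
      (4 : ℂ)⁻¹ • (Z + T * Z - Z * T - T * Z * T) + (4 : ℂ)⁻¹ • (Z' + T * Z' - Z' * T - T * Z' * T) := by
  simp only [mul_add, add_mul]
  module

end Raise

variable {V : Type u} [AddCommGroup V] [Module ℚ V] [Module.Finite ℚ V] [HodgeTensorFacts.{u, u}] {n : ℤ}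

/-! ## §1 `End_Hdg = ℚ ⟹ 𝔷 = 0` -/

/-- **If every Hodge endomorphism is a rational scalar then `𝔷 = Lie Hg ∩ End_Hdg = 0`**: an element of the intersection is
`x · 1` and `ψ`-skew (`form_apply_add_eq_zero_of_mem_hodgeLie`), so `2x ψ(v, w) = 0` for all `v, w`, i.e. `ψ(xv, ·) = 0` and
`xv = 0` (`ψ` non-degenerate). (Deligne I 3.6: `𝔷 ⊆ End_Hdg`, on which the polarization involution acts.)
[cite: Deligne1982HodgeCycles, I §3 Prop. 3.6] [cite: MoonenZarhin1999LowDim, §2 (2.2)] -/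
theorem hodgeLie_inf_endAlg_eq_bot_of_forall_endAlg_eq_smul (H : HodgeStructure V n) (ψ : H.Polarization)
    (hE : ∀ a ∈ H.endAlg, ∃ x : ℚ, a = x • 1) : H.hodgeLie ⊓ Subalgebra.toSubmodule H.endAlg = ⊥ := by
  rw [eq_bot_iff]
  intro z hz
  obtain ⟨hz𝔥, hzE⟩ := Submodule.mem_inf.1 hz
  obtain ⟨x, rfl⟩ := hE z hzE
  rw [Submodule.mem_bot]
  refine LinearMap.ext fun v => ?_
  rw [LinearMap.zero_apply, LinearMap.smul_apply, Module.End.one_apply]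
  refine ψ.nondegenerate.1 (x • v) fun w => ?_
  have h := form_apply_add_eq_zero_of_mem_hodgeLie ψ hz𝔥 v w
  simp only [LinearMap.smul_apply, Module.End.one_apply, map_smul, smul_eq_mul] at h
  rw [map_smul, LinearMap.smul_apply, smul_eq_mul]
  linear_combination h / 2

/-! ## §2 A `Θ`-subalgebra criterion: bracket-closed `𝔞 ⊆ 𝔥` with `B₀ ∈ 𝔞_ℂ` is `𝔥` -/

/-- **A bracket-closed rational `𝔞 ⊆ Lie Hg` whose complex span contains the raising operator `B₀` of a plus pair is all of
`Lie Hg`.**  With `C₀ = B̄₀` (so `C₀ ∈ 𝔞_ℂ`, the complex span of a rational subspace being conjugation-stable), `B₀C₀ = μ₀` on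
`V^{1,0}`, `C₀B₀ = μ₀` on `V^{0,1}`, `μ₀ ≠ 0`: `[B₀, C₀] = μ₀Θ ∈ 𝔞_ℂ`, and `Lie Hg` is the smallest bracket-closed rational
subspace whose complexification contains `Θ` (`hodgeLie_rigid`). [cite: MoonenZarhin1999LowDim, §3 (3.1)]
[cite: Deligne1982HodgeCycles, I §3 Prop. 3.4 and Prop. 3.6] -/
theorem hodgeLie_le_of_plusPair_mem_spanC (H : HodgeStructure V n) (ψ : H.Polarization) (hn : n = 1)
    (heff : H.IsEffective) {Θ : Module.End ℂ (ℂ ⊗[ℚ] V)}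
    (hΘ : ∀ p, ∀ x ∈ H.piece p (n - p), Θ x = ((2 * p - n : ℤ) : ℂ) • x)
    {B₀ C₀ : Module.End ℂ (ℂ ⊗[ℚ] V)} (hB₀P : ∀ p ∈ H.piece 1 0, B₀ p = 0)
    (hC₀ : ∀ v, C₀ v = conj (B₀ (conj v))) {μ₀ : ℂ} (hμ₀ : μ₀ ≠ 0)
    (hBC : ∀ p ∈ H.piece 1 0, B₀ (C₀ p) = μ₀ • p) (hCB : ∀ q ∈ H.piece 0 1, C₀ (B₀ q) = μ₀ • q)
    (𝔞 : Submodule ℚ (Module.End ℚ V)) (h𝔞 : 𝔞 ≤ H.hodgeLie) (hbr : ∀ X ∈ 𝔞, ∀ Y ∈ 𝔞, X * Y - Y * X ∈ 𝔞)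
    (hB₀𝔞 : B₀ ∈ spanC 𝔞) : H.hodgeLie ≤ 𝔞 := by
  subst hn
  obtain ⟨hPmem, hQmem, hΘ10, hΘ01, -⟩ := UnitaryTheta.theta_facts H rfl heff hΘ
  have hC₀𝔞 : C₀ ∈ spanC 𝔞 := conjOp_mem_spanC hB₀𝔞 hC₀
  have hbr𝔞 : B₀ * C₀ - C₀ * B₀ ∈ spanC 𝔞 := commutator_mem_spanC hbr hB₀𝔞 hC₀𝔞
  have hC₀Q : ∀ q ∈ H.piece 0 1, C₀ q = 0 := fun q hq => by
    rw [hC₀, hB₀P _ (conj_mem_piece H hq), map_zero]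
  have hPQv : ∀ v : ℂ ⊗[ℚ] V, (2 : ℂ)⁻¹ • (v + Θ v) + (2 : ℂ)⁻¹ • (v - Θ v) = v := fun v => by module
  have hext : ∀ Y Y' : Module.End ℂ (ℂ ⊗[ℚ] V), (∀ p ∈ H.piece 1 0, Y p = Y' p) →
      (∀ q ∈ H.piece 0 1, Y q = Y' q) → Y = Y' := fun Y Y' h1 h2 =>
    LinearMap.ext fun v => by rw [← hPQv v, map_add, map_add, h1 _ (hPmem v), h2 _ (hQmem v)]
  -- `[B₀, C₀] = μ₀ Θ`
  have hcomm : B₀ * C₀ - C₀ * B₀ = μ₀ • Θ :=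
    hext _ _ (fun p hp => by
        rw [LinearMap.sub_apply, Module.End.mul_apply, Module.End.mul_apply, hBC p hp, hB₀P p hp, map_zero, sub_zero,
          LinearMap.smul_apply, hΘ10 p hp])
      (fun q hq => by
        rw [LinearMap.sub_apply, Module.End.mul_apply, Module.End.mul_apply, hC₀Q q hq, map_zero, zero_sub, hCB q hq,
          LinearMap.smul_apply, hΘ01 q hq, smul_neg])
  have hΘ𝔞 : Θ ∈ spanC 𝔞 := by
    have h : Θ = μ₀⁻¹ • (B₀ * C₀ - C₀ * B₀) := by rw [hcomm, smul_smul, inv_mul_cancel₀ hμ₀, one_smul]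
    rw [h]
    exact Submodule.smul_mem _ _ hbr𝔞
  exact hodgeLie_rigid H ⟨ψ⟩ 𝔞 h𝔞 hbr ⟨Θ, hΘ𝔞, hΘ⟩

/-! ## §3 Plus line and `𝔷 = 0` ⟹ `Lie Hg` is `ℚ`-simple -/

set_option maxHeartbeats 800000 in
/-- **In the plus-line position with `𝔷 = 0`, `Lie Hg(H)` is a SIMPLE Lie algebra over `ℚ`** (weight `1`): for every Lie
subalgebra `𝔏 ≤ 𝔤𝔩_ℚ(V)` with carrier `Lie Hg(H)`, `LieAlgebra.IsSimple ℚ 𝔏`.  `𝔷 = 0` gives `𝔥 = [𝔥, 𝔥]` semisimple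
(Deligne I 3.6); for an ideal `I` with complement `J` (`[I, J] = 0`, `I ⊕ J = 𝔥`) write `B₀ = Y_I + Y_J` in `𝔥_ℂ = I_ℂ + J_ℂ`;
the raising components of `Y_I`, `Y_J` lie in `I_ℂ`, `J_ℂ` (ideals are `ad Θ`-stable, `Θ ∈ 𝔥_ℂ`) and are multiples `aB₀`, `bB₀`
with `a + b = 1` (plus LINE); `a ≠ 0` gives `B₀ ∈ I_ℂ` and `I = 𝔥` (`hodgeLie_le_of_plusPair_mem_spanC`), `a = 0` gives
`B₀ ∈ J_ℂ`, `J = 𝔥`, `I = I ∩ J = 0`; and `𝔥` is not abelian since `0 ≠ B₀ ∈ 𝔥_ℂ = [𝔥, 𝔥]_ℂ`.  This is Deligne's remark that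
`Hg` is `ℚ`-simple as soon as `μ` projects non-trivially to a single `ℚ`-simple factor, in the Mumford / type-III position of
Moonen–Zarhin (2.3). [cite: Deligne1982HodgeCycles, I §3 Prop. 3.4, Prop. 3.6 and Example 3.7]
[cite: MoonenZarhin1999LowDim, §2 (2.3) and §3 (3.1)] [cite: Humphreys1972, §5.2] -/
theorem isSimple_hodgeLie_of_plusLine (H : HodgeStructure V n) (ψ : H.Polarization) (hn : n = 1)
    (heff : H.IsEffective) {Θ : Module.End ℂ (ℂ ⊗[ℚ] V)}
    (hΘ : ∀ p, ∀ x ∈ H.piece p (n - p), Θ x = ((2 * p - n : ℤ) : ℂ) • x)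
    {B₀ C₀ : Module.End ℂ (ℂ ⊗[ℚ] V)} (hB₀ : B₀ ∈ H.hodgeLieC) (hB₀0 : B₀ ≠ 0)
    (hB₀P : ∀ p ∈ H.piece 1 0, B₀ p = 0) (hB₀im : ∀ v, B₀ v ∈ H.piece 1 0)
    (hC₀ : ∀ v, C₀ v = conj (B₀ (conj v))) {μ₀ : ℂ} (hμ₀ : μ₀ ≠ 0)
    (hBC : ∀ p ∈ H.piece 1 0, B₀ (C₀ p) = μ₀ • p) (hCB : ∀ q ∈ H.piece 0 1, C₀ (B₀ q) = μ₀ • q)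
    (hline : ∀ B ∈ H.hodgeLieC, (∀ p ∈ H.piece 1 0, B p = 0) → (∀ v, B v ∈ H.piece 1 0) → ∃ c : ℂ, B = c • B₀)
    (hz : H.hodgeLie ⊓ Subalgebra.toSubmodule H.endAlg = ⊥) :
    letI : LieRing (Module.End ℚ V) := LieRing.ofAssociativeRing
    ∀ 𝔏 : LieSubalgebra ℚ (Module.End ℚ V), 𝔏.toSubmodule = H.hodgeLie → LieAlgebra.IsSimple ℚ 𝔏 := by
  letI : LieRing (Module.End ℚ V) := LieRing.ofAssociativeRing
  intro 𝔏 h𝔏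
  classical
  have hle := fun (𝔞 : Submodule ℚ (Module.End ℚ V)) (h𝔞 : 𝔞 ≤ H.hodgeLie)
      (hbr : ∀ X ∈ 𝔞, ∀ Y ∈ 𝔞, X * Y - Y * X ∈ 𝔞) (hB₀𝔞 : B₀ ∈ spanC 𝔞) =>
    hodgeLie_le_of_plusPair_mem_spanC H ψ hn heff hΘ hB₀P hC₀ hμ₀ hBC hCB 𝔞 h𝔞 hbr hB₀𝔞
  subst hn
  obtain ⟨hPmem, hQmem, hΘ10, hΘ01, hΘΘ⟩ := UnitaryTheta.theta_facts H rfl heff hΘ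
  have hΘM : Θ ∈ H.hodgeLieC := H.mem_hodgeLieC_of_forall_piece hΘ
  -- `𝔷 = 0`: the derived algebra is everything, so `𝔏` is semisimple
  set 𝔡 := Submodule.span ℚ {B | ∃ X ∈ H.hodgeLie, ∃ Y ∈ H.hodgeLie, X * Y - Y * X = B} with h𝔡def
  have h𝔡 : 𝔡 = H.hodgeLie := by
    have h := AnyWeight.hodgeLie_center_sup_derived_eq H ψ
    rwa [hz, bot_sup_eq] at h
  haveI hss : LieAlgebra.IsSemisimple ℚ 𝔏 :=
    AnyWeight.isSemisimple_of_eq_hodgeLie_derived H ψ 𝔏 (h𝔏.trans h𝔡.symm)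
  have hmem𝔏 : ∀ {x : Module.End ℚ V}, x ∈ 𝔏 ↔ x ∈ H.hodgeLie := fun {x} => by
    rw [← LieSubalgebra.mem_toSubmodule, h𝔏]
  -- the rational subspace of `End V` underlying an ideal of `𝔏`
  let ι : LieIdeal ℚ 𝔏 → Submodule ℚ (Module.End ℚ V) := fun I =>
    { carrier := {x | ∃ y : 𝔏, y ∈ I ∧ (y : Module.End ℚ V) = x}
      zero_mem' := ⟨0, I.zero_mem, rfl⟩
      add_mem' := by
        rintro _ _ ⟨y, hy, rfl⟩ ⟨y', hy', rfl⟩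
        exact ⟨y + y', add_mem hy hy', rfl⟩
      smul_mem' := by
        rintro c _ ⟨y, hy, rfl⟩
        exact ⟨c • y, (I : Submodule ℚ 𝔏).smul_mem c hy, rfl⟩ }
  have hι : ∀ (I : LieIdeal ℚ 𝔏) (x : Module.End ℚ V), x ∈ ι I ↔ ∃ y : 𝔏, y ∈ I ∧ (y : Module.End ℚ V) = x :=
    fun I x => Iff.rfl
  have hιle : ∀ I : LieIdeal ℚ 𝔏, ι I ≤ H.hodgeLie := by
    rintro I _ ⟨y, -, rfl⟩
    exact hmem𝔏.1 y.2
  have hιid : ∀ I : LieIdeal ℚ 𝔏, ∀ X ∈ H.hodgeLie, ∀ A ∈ ι I, X * A - A * X ∈ ι I := by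
    rintro I X hX _ ⟨y, hy, rfl⟩
    refine ⟨⁅(⟨X, hmem𝔏.2 hX⟩ : 𝔏), y⁆, I.lie_mem hy, ?_⟩
    rw [LieSubalgebra.coe_bracket, Ring.lie_def]
  have hιbr : ∀ I : LieIdeal ℚ 𝔏, ∀ X ∈ ι I, ∀ A ∈ ι I, X * A - A * X ∈ ι I :=
    fun I X hX A hA => hιid I X (hιle I hX) A hA
  have hιC : ∀ I : LieIdeal ℚ 𝔏, spanC (ι I) ≤ H.hodgeLieC := fun I => by
    rw [hodgeLieC_eq_spanC]
    exact spanC_mono (hιle I)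
  have had : ∀ I : LieIdeal ℚ 𝔏, ∀ Z ∈ spanC (ι I), Θ * Z - Z * Θ ∈ spanC (ι I) := fun I Z hZ =>
    bracket_mem_spanC_of_ideal (hιid I) (by rw [← hodgeLieC_eq_spanC]; exact hΘM) hZ
  -- an ideal whose complex span contains `B₀` is everything
  have key : ∀ I : LieIdeal ℚ 𝔏, B₀ ∈ spanC (ι I) → I = ⊤ := by
    intro I hBI
    have h := hle (ι I) (hιle I) (hιbr I) hBI
    rw [eq_top_iff]
    rintro y -
    obtain ⟨y', hy', hyy'⟩ := (hι I y).1 (h (hmem𝔏.1 y.2))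
    exact (Subtype.ext hyy') ▸ hy'
  -- pieces bookkeeping
  have hPQv : ∀ v : ℂ ⊗[ℚ] V, (2 : ℂ)⁻¹ • (v + Θ v) + (2 : ℂ)⁻¹ • (v - Θ v) = v := fun v => by module
  have hext : ∀ Y Y' : Module.End ℂ (ℂ ⊗[ℚ] V), (∀ p ∈ H.piece 1 0, Y p = Y' p) →
      (∀ q ∈ H.piece 0 1, Y q = Y' q) → Y = Y' := fun Y Y' h1 h2 =>
    LinearMap.ext fun v => by rw [← hPQv v, map_add, map_add, h1 _ (hPmem v), h2 _ (hQmem v)]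
  have hTfix : ∀ x : ℂ ⊗[ℚ] V, Θ x = x → x ∈ H.piece 1 0 := fun x hx => by
    have h := hPmem x
    rwa [hx, ← two_smul ℂ x, smul_smul, inv_mul_cancel₀ (two_ne_zero' ℂ), one_smul] at h
  have hRP : ∀ Y : Module.End ℂ (ℂ ⊗[ℚ] V), ∀ p ∈ H.piece 1 0,
      ((4 : ℂ)⁻¹ • (Y + Θ * Y - Y * Θ - Θ * Y * Θ)) p = 0 := fun Y p hp =>
    UnitaryTheta.raise_apply_of_eq Θ Y (hΘ10 p hp)
  have hRim : ∀ Y : Module.End ℂ (ℂ ⊗[ℚ] V), ∀ v,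
      ((4 : ℂ)⁻¹ • (Y + Θ * Y - Y * Θ - Θ * Y * Θ)) v ∈ H.piece 1 0 := fun Y v =>
    hTfix _ (UnitaryTheta.apply_raise_apply hΘΘ Y v)
  have hRB₀ : (4 : ℂ)⁻¹ • (B₀ + Θ * B₀ - B₀ * Θ - Θ * B₀ * Θ) = B₀ :=
    hext _ _ (fun p hp => by rw [hRP B₀ p hp, hB₀P p hp])
      (fun q hq => by
        rw [UnitaryTheta.raise_apply_of_eq_neg Θ B₀ (hΘ01 q hq), hΘ10 _ (hB₀im q)]
        module)
  refine ⟨fun I => ?_, fun hab => ?_⟩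
  · -- every ideal is `⊥` or `⊤`
    set J : LieIdeal ℚ 𝔏 := Iᶜ with hJ
    have hIJ : I ⊓ J = ⊥ := inf_compl_eq_bot
    have hIJ' : I ⊔ J = ⊤ := sup_compl_eq_top
    -- `𝔥_ℂ ⊆ I_ℂ + J_ℂ`
    have hsum : H.hodgeLieC ≤ spanC (ι I) ⊔ spanC (ι J) := by
      refine Submodule.span_le.2 ?_
      rintro _ ⟨X, hX, rfl⟩
      have hx : (⟨X, hmem𝔏.2 hX⟩ : 𝔏) ∈ I ⊔ J := by rw [hIJ']; exact LieSubmodule.mem_top _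
      obtain ⟨xI, hxI, xJ, hxJ, hx'⟩ := (LieSubmodule.mem_sup _ _ _).1 hx
      have hX' : X = (xI : Module.End ℚ V) + xJ := by
        have h := congrArg (fun w : 𝔏 => (w : Module.End ℚ V)) hx'
        simpa only [AddMemClass.coe_add] using h.symm
      change X.baseChange ℂ ∈ spanC (ι I) ⊔ spanC (ι J)
      rw [hX', LinearMap.baseChange_add]
      exact Submodule.add_mem_sup (baseChange_mem_spanC ⟨xI, hxI, rfl⟩) (baseChange_mem_spanC ⟨xJ, hxJ, rfl⟩)
    obtain ⟨YI, hYI, YJ, hYJ, hYsum⟩ := Submodule.mem_sup.1 (hsum hB₀)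
    have hRI := PlusLineSimple.raise_mem_of_ad_stable (had I) hΘΘ hYI
    have hRJ := PlusLineSimple.raise_mem_of_ad_stable (had J) hΘΘ hYJ
    obtain ⟨a, ha⟩ := hline _ (hιC I hRI) (hRP YI) (hRim YI)
    obtain ⟨b, hb⟩ := hline _ (hιC J hRJ) (hRP YJ) (hRim YJ)
    have hab : a + b = 1 := by
      have h : (4 : ℂ)⁻¹ • (B₀ + Θ * B₀ - B₀ * Θ - Θ * B₀ * Θ) =
          (4 : ℂ)⁻¹ • (YI + Θ * YI - YI * Θ - Θ * YI * Θ) + (4 : ℂ)⁻¹ • (YJ + Θ * YJ - YJ * Θ - Θ * YJ * Θ) := by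
        rw [← hYsum]
        exact PlusLineSimple.raise_add Θ YI YJ
      rw [hRB₀, ha, hb, ← add_smul] at h
      have h2 : (a + b - 1) • B₀ = 0 := by
        calc (a + b - 1) • B₀ = (a + b) • B₀ - B₀ := by module
          _ = 0 := by rw [← h, sub_self]
      rcases smul_eq_zero.1 h2 with h3 | h3
      · exact sub_eq_zero.1 h3
      · exact absurd h3 hB₀0
    rcases eq_or_ne a 0 with ha0 | ha0
    · -- `B₀ ∈ J_ℂ`: `J = ⊤`, `I = ⊥`
      left
      have hb1 : b = 1 := by rwa [ha0, zero_add] at hab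
      have hBJ : B₀ ∈ spanC (ι J) := by
        have h : B₀ = (4 : ℂ)⁻¹ • (YJ + Θ * YJ - YJ * Θ - Θ * YJ * Θ) := by rw [hb, hb1, one_smul]
        rw [h]
        exact hRJ
      have hJtop := key J hBJ
      calc I = I ⊓ J := by rw [hJtop, inf_top_eq]
        _ = ⊥ := hIJ
    · -- `B₀ ∈ I_ℂ`: `I = ⊤`
      right
      refine key I ?_
      have h : B₀ = a⁻¹ • ((4 : ℂ)⁻¹ • (YI + Θ * YI - YI * Θ - Θ * YI * Θ)) := by
        rw [ha, smul_smul, inv_mul_cancel₀ ha0, one_smul]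
      rw [h]
      exact Submodule.smul_mem _ _ hRI
  · -- not abelian: `0 ≠ B₀ ∈ 𝔥_ℂ`
    apply hB₀0
    have h𝔡0 : 𝔡 ≤ ⊥ := by
      refine Submodule.span_le.2 ?_
      rintro _ ⟨X, hX, Y, hY, rfl⟩
      have h := hab.trivial (⟨X, hmem𝔏.2 hX⟩ : 𝔏) ⟨Y, hmem𝔏.2 hY⟩
      have h' := congrArg (fun w : 𝔏 => (w : Module.End ℚ V)) h
      simp only [LieSubalgebra.coe_bracket, Ring.lie_def, ZeroMemClass.coe_zero] at h'
      rw [SetLike.mem_coe, Submodule.mem_bot]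
      exact h'
    have hC0 : H.hodgeLieC ≤ ⊥ := by
      refine Submodule.span_le.2 ?_
      rintro _ ⟨X, hX, rfl⟩
      have hX' : X ∈ 𝔡 := by rw [h𝔡]; exact hX
      have hX0 : X = 0 := (Submodule.mem_bot ℚ).1 (h𝔡0 hX')
      change X.baseChange ℂ ∈ (⊥ : Submodule ℂ (Module.End ℂ (ℂ ⊗[ℚ] V)))
      rw [hX0, LinearMap.baseChange_zero]
      exact Submodule.zero_mem _
    exact (Submodule.mem_bot ℂ).1 (hC0 hB₀)

/-! ## §4 Plus line and `End_Hdg = ℚ` ⟹ `Lie Hg` is `ℚ`-simple -/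

/-- **Plus-line position with `End_Hdg(V) = ℚ` ⟹ `Lie Hg(H)` is `ℚ`-simple** (`𝔷 = 0` by
`hodgeLie_inf_endAlg_eq_bot_of_forall_endAlg_eq_smul`). [cite: Deligne1982HodgeCycles, I §3 Prop. 3.4, Prop. 3.6 and Example 3.7]
[cite: MoonenZarhin1999LowDim, §2 (2.3) and §3 (3.1)] -/
theorem isSimple_hodgeLie_of_plusLine_of_forall_endAlg_eq_smul (H : HodgeStructure V n) (ψ : H.Polarization)
    (hn : n = 1) (heff : H.IsEffective) (hE : ∀ a ∈ H.endAlg, ∃ x : ℚ, a = x • 1) {Θ : Module.End ℂ (ℂ ⊗[ℚ] V)}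
    (hΘ : ∀ p, ∀ x ∈ H.piece p (n - p), Θ x = ((2 * p - n : ℤ) : ℂ) • x)
    {B₀ C₀ : Module.End ℂ (ℂ ⊗[ℚ] V)} (hB₀ : B₀ ∈ H.hodgeLieC) (hB₀0 : B₀ ≠ 0)
    (hB₀P : ∀ p ∈ H.piece 1 0, B₀ p = 0) (hB₀im : ∀ v, B₀ v ∈ H.piece 1 0)
    (hC₀ : ∀ v, C₀ v = conj (B₀ (conj v))) {μ₀ : ℂ} (hμ₀ : μ₀ ≠ 0)
    (hBC : ∀ p ∈ H.piece 1 0, B₀ (C₀ p) = μ₀ • p) (hCB : ∀ q ∈ H.piece 0 1, C₀ (B₀ q) = μ₀ • q)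
    (hline : ∀ B ∈ H.hodgeLieC, (∀ p ∈ H.piece 1 0, B p = 0) → (∀ v, B v ∈ H.piece 1 0) → ∃ c : ℂ, B = c • B₀) :
    letI : LieRing (Module.End ℚ V) := LieRing.ofAssociativeRing
    ∀ 𝔏 : LieSubalgebra ℚ (Module.End ℚ V), 𝔏.toSubmodule = H.hodgeLie → LieAlgebra.IsSimple ℚ 𝔏 :=
  isSimple_hodgeLie_of_plusLine H ψ hn heff hΘ hB₀ hB₀0 hB₀P hB₀im hC₀ hμ₀ hBC hCB hline
    (hodgeLie_inf_endAlg_eq_bot_of_forall_endAlg_eq_smul H ψ hE)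

end HodgeStructure

end Literature.AlgebraicGeometry.Motives
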